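import Summits.HodgeConjecture.HodgeConjecture.Theorems.H413SpectrumJunctionPin
import Summits.HodgeConjecture.HodgeConjecture.Theorems.H413SpectrumOrthogonality
import Summits.HodgeConjecture.HodgeConjecture.Theorems.H413CohFormsHodgeTypesDisjoint
import Summits.HodgeConjecture.HodgeConjecture.Theorems.P4StubT1ArchFactor
import HarnessLib

/-!
# FLOOR-0 junction T7 AT THE PIN, glue g1-an / g2: the cotangent PARTS of the discrete automorphic representations of `U(V)` are
# an INDEPENDENT family of `rightRep`-STABLE submodules (given letter E1 and an `L²` realisation with continuous descents)

Cell hodgecm-mathlib, FLOOR 0; crux item H413 = stmt-HodgeConjecture-24833 (route `HCCMUnconditional`); prover F0P3-p04 (g0),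
share «junction T7» (integrator's JUNCTION SPEC `F0/P3/ENGINE-INTERFACES.F0P3g0.md` §6/§6a).  PROOF FILE: theorems only — no
definition, no instance, no notation, no named fact, no `sorry`.  HONEST LABEL: HC_CM is proved only modulo the printed citations
until rung 0 closes.

SETTING.  `F` a CM field with `4 ≤ [F:ℚ]`, `V : HermSpace3 F ι₁`, the pin's group datum `adelicDatum F V` (compact automorphic
quotient, ★ `SpectrumJunction.compactSpace_automorphicQuotient_adelicDatum`), an automorphic measure `μ`, an archimedean factor
`𝔞 : ArchFactor F V` (honest where stability is concerned; the factor of record `archFactorOf F V` is honest, ★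
`P4StubT1ArchFactor.archFactorOf_isHonest`), and an `L²` REALISATION `ℓ : (U(V)(𝔸) → ℂ²) →ₗ[ℂ] (Fin 2 → L²(μ))` with CONTINUOUS
DESCENTS on `cohForms 𝔞` — the hypothesis
`hrep : ∀ f ∈ cohForms 𝔞, ∀ k, ∃ φ : C(quotient, ℂ), (∀ h, φ [h] = f h⁻¹ k) ∧ ℓ f k =ᵐ[μ] φ`,
which is programme P2's `Represents F V 𝔞 μ ℓ` (`Cruxes/H413/Lines/F0_P2CohSpectrumL2.lean` §2b) UNFOLDED (its stub U2ℓ supplies it).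
The PARTS are written in the token shape of P2's `cotPart / holPart / antiholPart 𝔞 μ ℓ Π`:
`A ⊓ ⨅ k : Fin 2, (P.space.toSubmodule).comap ((LinearMap.proj k).comp ℓ)` with `A = cohForms 𝔞 / holCotForms 𝔞 / (holCotForms 𝔞).map conjFun`.

WHAT IS PROVED:
* `two_le_finrank_maximalRealSubfield` (`4 ≤ [F:ℚ] ⇒ 2 ≤ [F⁺:ℚ]`); `hasMultiplicityOne_rightRegular_pin`, `isOrtho_space_of_ne_pin`,
  `iSupIndep_space_pin`: the ENGINE LETTER E1 ★ `Rogawski1990.innerFormMultiplicityLeOne` (HYPOTHESIS BY NAME) at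
  `(K F, ι₁, Hm V, V.sylvesterFrame, posDef_of_ne)` gives multiplicity one of `L²(U(V)(F⁺)\U(V)(𝔸_{F⁺}))`, orthogonality of distinct
  discrete `Π`, independence of `Π ↦ Π.space` ([Rogawski1990, §14.6]; [Dixmier1977, §5.4]);
* `injOn_cohForms_of_descents`: `ℓ` is injective on `cohForms 𝔞` coordinatewise (continuous descents + measure positive on open sets);
  `apply_eq_toLp_of_descents` (`ℓ f k` IS the class of `toQuotFun (f · k)`), `transport_of_descents`
  (`ℓ (rightRep F V g f) k = R(1, g) (ℓ f k)` at an honest `𝔞` — programme P2's junction identity);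
* g1-an `iSupIndep_cotParts_pin / _holParts_pin / _antiholParts_pin`: the three families of parts are INDEPENDENT (E1 + injectivity,
  ★ `SpectrumJunction.iSupIndep_parts_of_injOn`);
* g2 `rightRep_mem_cotPart_pin / _holPart_pin / _antiholPart_pin`: each part is `rightRep F V g`-STABLE at an honest `𝔞`
  (★ `IsHonest.rightRep_mem_cohForms / _holCotForms / _map_conjFun_holCotForms` + transport + invariance of `Π.space`).
The equivariant-components ALGEBRA over such a family is A-p09 (g18)'s `Theorems/F0P3EquivariantComponents.lean`.

## References
* [Rogawski1990] J. Rogawski, Ann. of Math. Stud. 123 (1990), §14.6 (multiplicity one on the inner forms).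
* [Dixmier1977] J. Dixmier, *C*-algebras* (1977), §5.4.
* [BorelJacquet1979] A. Borel, H. Jacquet, PSPM 33.1 (1979), §4.2, §4.6.
-/

set_option autoImplicit false

-- the mandated namespace has the single-problem summit's repeated segment (`HodgeConjecture.HodgeConjecture`)
set_option linter.dupNamespace false

noncomputable section

namespace Summit.HodgeConjecture.HodgeConjecture.Cruxes.H413.SpectrumJunction

open MeasureTheory NumberField Topology
open scoped ENNReal InnerProductSpace
open Literature.NumberTheory.Automorphic Literature.NumberTheory.Automorphic.UnitaryGroup
open Literature.NumberTheory.Automorphic.UnitaryGroup.CotangentForms (toQuotFun toQuotFun_mk)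
open Summit.HodgeConjecture.HodgeConjecture.Cruxes.H413.CohFormsCarriers

section Pin

variable (F : HodgeCM.CMField) {ι₁ : F →+* ℂ} (V : HodgeCM.HermSpace3 F ι₁)

/-! ## §1 Multiplicity one, orthogonality and independence of the discrete spectrum of `U(V)` (letter E1 by name) -/

/-- `4 ≤ [F:ℚ] ⇒ 2 ≤ [F⁺:ℚ]` (`[F:F⁺] = 2` for a CM field). [folklore] -/
theorem two_le_finrank_maximalRealSubfield (h4 : 4 ≤ Module.finrank ℚ F) :
    2 ≤ Module.finrank ℚ ↥(maximalRealSubfield (HodgeCM.CMField.K F)) := by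
  have h := Module.finrank_mul_finrank ℚ ↥(maximalRealSubfield (HodgeCM.CMField.K F)) (HodgeCM.CMField.K F)
  rw [Algebra.IsQuadraticExtension.finrank_eq_two ↥(maximalRealSubfield (HodgeCM.CMField.K F)) (HodgeCM.CMField.K F)] at h
  change _ = Module.finrank ℚ F at h
  omega

/-- **E1 ⇒ `L²(U(V)(F⁺)\U(V)(𝔸_{F⁺}), μ)` has MULTIPLICITY ONE** (the letter at `(K F, ι₁, Hm V, V.sylvesterFrame, posDef_of_ne)`).
[cite: Rogawski1990, §14.6 Thm. 14.6.4] [cite: Dixmier1977, §5.4] -/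
theorem hasMultiplicityOne_rightRegular_pin (hE1 : Literature.NumberTheory.Rogawski1990.innerFormMultiplicityLeOne)
    (h4 : 4 ≤ Module.finrank ℚ F) (μ : Measure (adelicDatum F V).automorphicQuotient) [(adelicDatum F V).IsAutomorphicMeasure μ] :
    ((adelicDatum F V).rightRegular μ).HasMultiplicityOne :=
  hasMultiplicityOne_rightRegular_of_innerFormMultiplicityLeOne hE1 (HodgeCM.CMField.K F) ι₁ (HodgeCM.HermSpace3.Hm V)
    V.sylvesterFrame (HodgeCM.Model.sylvesterFrame_J V) V.posDef_of_ne (two_le_finrank_maximalRealSubfield F h4) μ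

/-- **E1 ⇒ distinct discrete automorphic representations of `U(V)` are ORTHOGONAL in `L²`.** [cite: Rogawski1990, §14.6 Thm. 14.6.4]
[cite: Dixmier1977, §5.4] -/
theorem isOrtho_space_of_ne_pin (hE1 : Literature.NumberTheory.Rogawski1990.innerFormMultiplicityLeOne)
    (h4 : 4 ≤ Module.finrank ℚ F) {μ : Measure (adelicDatum F V).automorphicQuotient} [(adelicDatum F V).IsAutomorphicMeasure μ]
    {P P' : DiscreteAutomorphicRep (adelicDatum F V) μ} (hne : P ≠ P') : P.space.toSubmodule ⟂ P'.space.toSubmodule :=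
  isOrtho_space_of_ne (hasMultiplicityOne_rightRegular_pin F V hE1 h4 μ) hne

/-- **E1 ⇒ the family `Π ↦ Π.space` of discrete automorphic representations of `U(V)` is INDEPENDENT.**
[cite: Rogawski1990, §14.6 Thm. 14.6.4] [cite: Dixmier1977, §5.4] -/
theorem iSupIndep_space_pin (hE1 : Literature.NumberTheory.Rogawski1990.innerFormMultiplicityLeOne)
    (h4 : 4 ≤ Module.finrank ℚ F) (μ : Measure (adelicDatum F V).automorphicQuotient) [(adelicDatum F V).IsAutomorphicMeasure μ] :
    iSupIndep fun P : DiscreteAutomorphicRep (adelicDatum F V) μ => P.space.toSubmodule :=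
  iSupIndep_space (hasMultiplicityOne_rightRegular_pin F V hE1 h4 μ)

/-! ## §2 An `L²` realisation with continuous descents: classes, injectivity, transport -/

variable {F V}

/-- Under continuous descents, **`ℓ f k` IS the class of `toQuotFun (f · k)`** for `f ∈ cohForms 𝔞` (with the `MemLp` witness of
★ `memLp_toQuotFun_pin`). [cite: BorelJacquet1979, §4.6] -/
theorem apply_eq_toLp_of_descents (h4 : 4 ≤ Module.finrank ℚ F) {μ : Measure (adelicDatum F V).automorphicQuotient}
    [(adelicDatum F V).IsAutomorphicMeasure μ] {𝔞 : ArchFactor F V}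
    (ℓ : ((adelicDatum F V).Adelic → (Fin 2 → ℂ)) →ₗ[ℂ] (Fin 2 → (adelicDatum F V).L2 μ))
    (hrep : ∀ f ∈ cohForms 𝔞, ∀ k : Fin 2, ∃ φ : C((adelicDatum F V).automorphicQuotient, ℂ),
      (∀ h, φ ((adelicDatum F V).toAutomorphicQuotient h) = f h⁻¹ k) ∧
        (((ℓ f k : (adelicDatum F V).L2 μ) : (adelicDatum F V).automorphicQuotient → ℂ) =ᵐ[μ] ⇑φ))
    {f : (adelicDatum F V).Adelic → (Fin 2 → ℂ)} (hf : f ∈ cohForms 𝔞) (k : Fin 2) :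
    ∃ hmem : MemLp (toQuotFun (adelicDatum F V) fun y => f y k) 2 μ, ℓ f k = hmem.toLp _ := by
  haveI := compactSpace_automorphicQuotient_adelicDatum F V h4
  obtain ⟨φ, hφ1, hφ2⟩ := hrep f hf k
  have hleft : ∀ γ ∈ (adelicDatum F V).quotientSubgroup, ∀ g, (fun y => f y k) (γ * g) = (fun y => f y k) g :=
    fun γ hγ g => by simp only [leftInvariant_of_mem_cohForms_pin hf γ hγ g]
  have hmem : MemLp (toQuotFun (adelicDatum F V) fun y => f y k) 2 μ :=
    memLp_toQuotFun hleft (continuous_of_continuous_descent φ hφ1) 2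
  exact ⟨hmem, eq_toLp_toQuotFun_of_descent hleft φ hφ1 (ℓ f k) hφ2 hmem⟩

/-- **`ℓ` is INJECTIVE on `cohForms 𝔞`, coordinatewise**: a cohomological cotangent form all of whose coordinate classes vanish is zero
(continuous descents; the automorphic measure is positive on open sets). [cite: BorelJacquet1979, §4.6] -/
theorem injOn_cohForms_of_descents (h4 : 4 ≤ Module.finrank ℚ F) {μ : Measure (adelicDatum F V).automorphicQuotient}
    [(adelicDatum F V).IsAutomorphicMeasure μ] {𝔞 : ArchFactor F V}
    (ℓ : ((adelicDatum F V).Adelic → (Fin 2 → ℂ)) →ₗ[ℂ] (Fin 2 → (adelicDatum F V).L2 μ))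
    (hrep : ∀ f ∈ cohForms 𝔞, ∀ k : Fin 2, ∃ φ : C((adelicDatum F V).automorphicQuotient, ℂ),
      (∀ h, φ ((adelicDatum F V).toAutomorphicQuotient h) = f h⁻¹ k) ∧
        (((ℓ f k : (adelicDatum F V).L2 μ) : (adelicDatum F V).automorphicQuotient → ℂ) =ᵐ[μ] ⇑φ)) :
    ∀ f ∈ cohForms 𝔞, (∀ k : Fin 2, ℓ f k = 0) → f = 0 := by
  haveI := compactSpace_automorphicQuotient_adelicDatum F V h4
  intro f hf h0
  funext x k
  obtain ⟨φ, hφ1, hφ2⟩ := hrep f hf k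
  have hleft : ∀ γ ∈ (adelicDatum F V).quotientSubgroup, ∀ g, (fun y => f y k) (γ * g) = (fun y => f y k) g :=
    fun γ hγ g => by simp only [leftInvariant_of_mem_cohForms_pin hf γ hγ g]
  have hcont : Continuous fun y => f y k := continuous_of_continuous_descent φ hφ1
  have hmem : MemLp (toQuotFun (adelicDatum F V) fun y => f y k) 2 μ := memLp_toQuotFun hleft hcont 2
  have hcl : ℓ f k = hmem.toLp _ := eq_toLp_toQuotFun_of_descent hleft φ hφ1 (ℓ f k) hφ2 hmem
  by_contra hx
  have hne : (fun y => f y k) ≠ 0 := fun h => hx (by simpa using congrFun h x)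
  refine toLp_toQuotFun_ne_zero hleft hcont hmem hne ?_
  rw [← hcl]
  exact h0 k

/-- **TRANSPORT under continuous descents** (programme P2's junction identity «`ℓ (R_g f) k = R(1,g) (ℓ f k)`»): at an HONEST `𝔞`,
for `f ∈ cohForms 𝔞` and `g ∈ U(V)(𝔸_{F⁺,f})`, `ℓ (rightRep F V g f) k = (adelicDatum F V).rightRegular μ (finToAdelic F V g) (ℓ f k)`.
[cite: BorelJacquet1979, §4.6] -/
theorem transport_of_descents (h4 : 4 ≤ Module.finrank ℚ F) {μ : Measure (adelicDatum F V).automorphicQuotient}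
    [(adelicDatum F V).IsAutomorphicMeasure μ] {𝔞 : ArchFactor F V} (h𝔞 : 𝔞.IsHonest)
    (ℓ : ((adelicDatum F V).Adelic → (Fin 2 → ℂ)) →ₗ[ℂ] (Fin 2 → (adelicDatum F V).L2 μ))
    (hrep : ∀ f ∈ cohForms 𝔞, ∀ k : Fin 2, ∃ φ : C((adelicDatum F V).automorphicQuotient, ℂ),
      (∀ h, φ ((adelicDatum F V).toAutomorphicQuotient h) = f h⁻¹ k) ∧
        (((ℓ f k : (adelicDatum F V).L2 μ) : (adelicDatum F V).automorphicQuotient → ℂ) =ᵐ[μ] ⇑φ))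
    {f : (adelicDatum F V).Adelic → (Fin 2 → ℂ)} (hf : f ∈ cohForms 𝔞) (g : ↥(HodgeCM.HermSpace3.adelicFin V)) (k : Fin 2) :
    ℓ (rightRep F V g f) k = (adelicDatum F V).rightRegular μ (finToAdelic F V g) (ℓ f k) := by
  obtain ⟨hmem, hcl⟩ := apply_eq_toLp_of_descents h4 ℓ hrep hf k
  obtain ⟨hmemg, hclg⟩ := apply_eq_toLp_of_descents h4 ℓ hrep (h𝔞.rightRep_mem_cohForms hf g) k
  rw [hcl, hclg]
  exact toLp_toQuotFun_rightRep_pin (leftInvariant_of_mem_cohForms_pin hf) g k hmem hmemg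

/-! ## §3 g1-an: the cotangent / holomorphic / antiholomorphic parts of the discrete `Π` are INDEPENDENT families -/

/-- **g1-an (cotangent parts)**: given E1 and an `L²` realisation with continuous descents, the family
`Π ↦ cohForms 𝔞 ⊓ ⨅ k, Π.space.comap (proj k ∘ ℓ)` (programme P2's `cotPart 𝔞 μ ℓ Π`) is independent.
[cite: Rogawski1990, §14.6 Thm. 14.6.4] [cite: Dixmier1977, §5.4] -/
theorem iSupIndep_cotParts_pin (hE1 : Literature.NumberTheory.Rogawski1990.innerFormMultiplicityLeOne)
    (h4 : 4 ≤ Module.finrank ℚ F) {μ : Measure (adelicDatum F V).automorphicQuotient} [(adelicDatum F V).IsAutomorphicMeasure μ]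
    {𝔞 : ArchFactor F V} (ℓ : ((adelicDatum F V).Adelic → (Fin 2 → ℂ)) →ₗ[ℂ] (Fin 2 → (adelicDatum F V).L2 μ))
    (hrep : ∀ f ∈ cohForms 𝔞, ∀ k : Fin 2, ∃ φ : C((adelicDatum F V).automorphicQuotient, ℂ),
      (∀ h, φ ((adelicDatum F V).toAutomorphicQuotient h) = f h⁻¹ k) ∧
        (((ℓ f k : (adelicDatum F V).L2 μ) : (adelicDatum F V).automorphicQuotient → ℂ) =ᵐ[μ] ⇑φ)) :
    iSupIndep fun P : DiscreteAutomorphicRep (adelicDatum F V) μ =>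
      cohForms 𝔞 ⊓ ⨅ k : Fin 2, (P.space.toSubmodule).comap ((LinearMap.proj k).comp ℓ) :=
  iSupIndep_parts_of_injOn (fun P : DiscreteAutomorphicRep (adelicDatum F V) μ => P.space.toSubmodule)
    (iSupIndep_space_pin F V hE1 h4 μ) (cohForms 𝔞) ℓ (injOn_cohForms_of_descents h4 ℓ hrep)

/-- **g1-an (holomorphic parts)**: the family `Π ↦ holCotForms 𝔞 ⊓ ⨅ k, Π.space.comap (proj k ∘ ℓ)` (P2's `holPart`) is independent.
[cite: Rogawski1990, §14.6 Thm. 14.6.4] [cite: Dixmier1977, §5.4] -/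
theorem iSupIndep_holParts_pin (hE1 : Literature.NumberTheory.Rogawski1990.innerFormMultiplicityLeOne)
    (h4 : 4 ≤ Module.finrank ℚ F) {μ : Measure (adelicDatum F V).automorphicQuotient} [(adelicDatum F V).IsAutomorphicMeasure μ]
    {𝔞 : ArchFactor F V} (ℓ : ((adelicDatum F V).Adelic → (Fin 2 → ℂ)) →ₗ[ℂ] (Fin 2 → (adelicDatum F V).L2 μ))
    (hrep : ∀ f ∈ cohForms 𝔞, ∀ k : Fin 2, ∃ φ : C((adelicDatum F V).automorphicQuotient, ℂ),
      (∀ h, φ ((adelicDatum F V).toAutomorphicQuotient h) = f h⁻¹ k) ∧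
        (((ℓ f k : (adelicDatum F V).L2 μ) : (adelicDatum F V).automorphicQuotient → ℂ) =ᵐ[μ] ⇑φ)) :
    iSupIndep fun P : DiscreteAutomorphicRep (adelicDatum F V) μ =>
      holCotForms 𝔞 ⊓ ⨅ k : Fin 2, (P.space.toSubmodule).comap ((LinearMap.proj k).comp ℓ) :=
  iSupIndep_parts_of_injOn (fun P : DiscreteAutomorphicRep (adelicDatum F V) μ => P.space.toSubmodule)
    (iSupIndep_space_pin F V hE1 h4 μ) (holCotForms 𝔞) ℓ
    fun f hf h0 => injOn_cohForms_of_descents h4 ℓ hrep f (Submodule.mem_sup_left hf) h0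

/-- **g1-an (antiholomorphic parts)**: the family `Π ↦ (holCotForms 𝔞).map conjFun ⊓ ⨅ k, Π.space.comap (proj k ∘ ℓ)` (P2's
`antiholPart`) is independent. [cite: Rogawski1990, §14.6 Thm. 14.6.4] [cite: Dixmier1977, §5.4] -/
theorem iSupIndep_antiholParts_pin (hE1 : Literature.NumberTheory.Rogawski1990.innerFormMultiplicityLeOne)
    (h4 : 4 ≤ Module.finrank ℚ F) {μ : Measure (adelicDatum F V).automorphicQuotient} [(adelicDatum F V).IsAutomorphicMeasure μ]
    {𝔞 : ArchFactor F V} (ℓ : ((adelicDatum F V).Adelic → (Fin 2 → ℂ)) →ₗ[ℂ] (Fin 2 → (adelicDatum F V).L2 μ))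
    (hrep : ∀ f ∈ cohForms 𝔞, ∀ k : Fin 2, ∃ φ : C((adelicDatum F V).automorphicQuotient, ℂ),
      (∀ h, φ ((adelicDatum F V).toAutomorphicQuotient h) = f h⁻¹ k) ∧
        (((ℓ f k : (adelicDatum F V).L2 μ) : (adelicDatum F V).automorphicQuotient → ℂ) =ᵐ[μ] ⇑φ)) :
    iSupIndep fun P : DiscreteAutomorphicRep (adelicDatum F V) μ =>
      (holCotForms 𝔞).map (conjFun F V) ⊓ ⨅ k : Fin 2, (P.space.toSubmodule).comap ((LinearMap.proj k).comp ℓ) :=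
  iSupIndep_parts_of_injOn (fun P : DiscreteAutomorphicRep (adelicDatum F V) μ => P.space.toSubmodule)
    (iSupIndep_space_pin F V hE1 h4 μ) ((holCotForms 𝔞).map (conjFun F V)) ℓ
    fun f hf h0 => injOn_cohForms_of_descents h4 ℓ hrep f (Submodule.mem_sup_right hf) h0

/-! ## §4 g2: the parts are `rightRep`-STABLE (honest `𝔞`) -/

/-- **g2 (cotangent part)**: at an honest `𝔞`, `rightRep F V g` preserves `cohForms 𝔞 ⊓ ⨅ k, Π.space.comap (proj k ∘ ℓ)` (P2's
`cotPart 𝔞 μ ℓ Π`): `cohForms 𝔞` is stable (★ `IsHonest.rightRep_mem_cohForms`), `ℓ` transports `rightRep g` to `R(1,g)`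
(`transport_of_descents`), and `Π.space` is `R`-invariant. [cite: BorelJacquet1979, §4.2, §4.6] -/
theorem rightRep_mem_cotPart_pin (h4 : 4 ≤ Module.finrank ℚ F) {μ : Measure (adelicDatum F V).automorphicQuotient}
    [(adelicDatum F V).IsAutomorphicMeasure μ] {𝔞 : ArchFactor F V} (h𝔞 : 𝔞.IsHonest)
    (ℓ : ((adelicDatum F V).Adelic → (Fin 2 → ℂ)) →ₗ[ℂ] (Fin 2 → (adelicDatum F V).L2 μ))
    (hrep : ∀ f ∈ cohForms 𝔞, ∀ k : Fin 2, ∃ φ : C((adelicDatum F V).automorphicQuotient, ℂ),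
      (∀ h, φ ((adelicDatum F V).toAutomorphicQuotient h) = f h⁻¹ k) ∧
        (((ℓ f k : (adelicDatum F V).L2 μ) : (adelicDatum F V).automorphicQuotient → ℂ) =ᵐ[μ] ⇑φ))
    (P : DiscreteAutomorphicRep (adelicDatum F V) μ) (g : ↥(HodgeCM.HermSpace3.adelicFin V))
    {f : (adelicDatum F V).Adelic → (Fin 2 → ℂ)}
    (hf : f ∈ cohForms 𝔞 ⊓ ⨅ k : Fin 2, (P.space.toSubmodule).comap ((LinearMap.proj k).comp ℓ)) :
    rightRep F V g f ∈ cohForms 𝔞 ⊓ ⨅ k : Fin 2, (P.space.toSubmodule).comap ((LinearMap.proj k).comp ℓ) :=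
  mem_part_of_mem (P.space.toSubmodule) (cohForms 𝔞) ℓ (rightRep F V g)
    (((adelicDatum F V).rightRegular μ (finToAdelic F V g) :
        (adelicDatum F V).L2 μ →L[ℂ] (adelicDatum F V).L2 μ) : (adelicDatum F V).L2 μ →ₗ[ℂ] (adelicDatum F V).L2 μ)
    (fun _ hf => h𝔞.rightRep_mem_cohForms hf g) (fun _ hf k => transport_of_descents h4 h𝔞 ℓ hrep hf g k)
    (fun _ hv => P.space.apply_mem (finToAdelic F V g) hv) hf

/-- **g2 (holomorphic part)**: at an honest `𝔞`, `rightRep F V g` preserves `holCotForms 𝔞 ⊓ ⨅ k, Π.space.comap (proj k ∘ ℓ)` (P2's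
`holPart`; ★ `IsHonest.rightRep_mem_holCotForms`). [cite: BorelJacquet1979, §4.2, §4.6] -/
theorem rightRep_mem_holPart_pin (h4 : 4 ≤ Module.finrank ℚ F) {μ : Measure (adelicDatum F V).automorphicQuotient}
    [(adelicDatum F V).IsAutomorphicMeasure μ] {𝔞 : ArchFactor F V} (h𝔞 : 𝔞.IsHonest)
    (ℓ : ((adelicDatum F V).Adelic → (Fin 2 → ℂ)) →ₗ[ℂ] (Fin 2 → (adelicDatum F V).L2 μ))
    (hrep : ∀ f ∈ cohForms 𝔞, ∀ k : Fin 2, ∃ φ : C((adelicDatum F V).automorphicQuotient, ℂ),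
      (∀ h, φ ((adelicDatum F V).toAutomorphicQuotient h) = f h⁻¹ k) ∧
        (((ℓ f k : (adelicDatum F V).L2 μ) : (adelicDatum F V).automorphicQuotient → ℂ) =ᵐ[μ] ⇑φ))
    (P : DiscreteAutomorphicRep (adelicDatum F V) μ) (g : ↥(HodgeCM.HermSpace3.adelicFin V))
    {f : (adelicDatum F V).Adelic → (Fin 2 → ℂ)}
    (hf : f ∈ holCotForms 𝔞 ⊓ ⨅ k : Fin 2, (P.space.toSubmodule).comap ((LinearMap.proj k).comp ℓ)) :
    rightRep F V g f ∈ holCotForms 𝔞 ⊓ ⨅ k : Fin 2, (P.space.toSubmodule).comap ((LinearMap.proj k).comp ℓ) :=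
  mem_part_of_mem (P.space.toSubmodule) (holCotForms 𝔞) ℓ (rightRep F V g)
    (((adelicDatum F V).rightRegular μ (finToAdelic F V g) :
        (adelicDatum F V).L2 μ →L[ℂ] (adelicDatum F V).L2 μ) : (adelicDatum F V).L2 μ →ₗ[ℂ] (adelicDatum F V).L2 μ)
    (fun _ hf => h𝔞.rightRep_mem_holCotForms hf g)
    (fun _ hf k => transport_of_descents h4 h𝔞 ℓ hrep (Submodule.mem_sup_left hf) g k)
    (fun _ hv => P.space.apply_mem (finToAdelic F V g) hv) hf

/-- **g2 (antiholomorphic part)**: at an honest `𝔞`, `rightRep F V g` preserves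
`(holCotForms 𝔞).map conjFun ⊓ ⨅ k, Π.space.comap (proj k ∘ ℓ)` (P2's `antiholPart`; ★ `IsHonest.rightRep_mem_map_conjFun_holCotForms`).
[cite: BorelJacquet1979, §4.2, §4.6] -/
theorem rightRep_mem_antiholPart_pin (h4 : 4 ≤ Module.finrank ℚ F) {μ : Measure (adelicDatum F V).automorphicQuotient}
    [(adelicDatum F V).IsAutomorphicMeasure μ] {𝔞 : ArchFactor F V} (h𝔞 : 𝔞.IsHonest)
    (ℓ : ((adelicDatum F V).Adelic → (Fin 2 → ℂ)) →ₗ[ℂ] (Fin 2 → (adelicDatum F V).L2 μ))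
    (hrep : ∀ f ∈ cohForms 𝔞, ∀ k : Fin 2, ∃ φ : C((adelicDatum F V).automorphicQuotient, ℂ),
      (∀ h, φ ((adelicDatum F V).toAutomorphicQuotient h) = f h⁻¹ k) ∧
        (((ℓ f k : (adelicDatum F V).L2 μ) : (adelicDatum F V).automorphicQuotient → ℂ) =ᵐ[μ] ⇑φ))
    (P : DiscreteAutomorphicRep (adelicDatum F V) μ) (g : ↥(HodgeCM.HermSpace3.adelicFin V))
    {f : (adelicDatum F V).Adelic → (Fin 2 → ℂ)}
    (hf : f ∈ (holCotForms 𝔞).map (conjFun F V) ⊓ ⨅ k : Fin 2, (P.space.toSubmodule).comap ((LinearMap.proj k).comp ℓ)) :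
    rightRep F V g f ∈ (holCotForms 𝔞).map (conjFun F V) ⊓ ⨅ k : Fin 2, (P.space.toSubmodule).comap ((LinearMap.proj k).comp ℓ) :=
  mem_part_of_mem (P.space.toSubmodule) ((holCotForms 𝔞).map (conjFun F V)) ℓ (rightRep F V g)
    (((adelicDatum F V).rightRegular μ (finToAdelic F V g) :
        (adelicDatum F V).L2 μ →L[ℂ] (adelicDatum F V).L2 μ) : (adelicDatum F V).L2 μ →ₗ[ℂ] (adelicDatum F V).L2 μ)
    (fun _ hf => h𝔞.rightRep_mem_map_conjFun_holCotForms hf g)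
    (fun _ hf k => transport_of_descents h4 h𝔞 ℓ hrep (Submodule.mem_sup_right hf) g k)
    (fun _ hv => P.space.apply_mem (finToAdelic F V g) hv) hf

/-- **The factor of record is honest** (★ `P4StubT1ArchFactor.archFactorOf_isHonest`), re-exported in this namespace for the folds:
all `h𝔞`-hypotheses above are discharged at `𝔞 = archFactorOf F V`. [cite: BorelJacquet1979, §4.1] -/
theorem archFactorOf_isHonest' : (archFactorOf F V).IsHonest :=
  P4StubT1ArchFactor.archFactorOf_isHonest F V

end Pin

end Summit.HodgeConjecture.HodgeConjecture.Cruxes.H413.SpectrumJunction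

end
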